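import Summits.BirchSwinnertonDyer.BirchSwinnertonDyer.Theorems.ManinLocalTwoThreeTowerDescent
import Summits.BirchSwinnertonDyer.BirchSwinnertonDyer.Theorems.ManinLocalTwoThreeQFareyCusps

/-!
# The INTEGER PLUS FUNCTIONAL `x ↦ ({∞,x}_f − {∞,0}_f + conj)/Ω⁺_f` of a rational newform on the cusps of denominator
# prime to `N`: existence and its formal properties (translation, evenness, `Γ₀(N)`-cocycle, Hecke relation at `q ∤ N`)

Summit `BirchSwinnertonDyer`, route `ManinLocalTwoThree` (cell bsd-f2-manin, analytic lens), cruxes C3 `ManinPrimeToThreeAtNine`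
(stmt-BirchSwinnertonDyer-22968) / C2 `ManinOddAtFour` (stmt-…-22967): the INSTANTIATION LAYER of the paper edge
`TowerExtension.RigidityImpliesTower` (MEMO-an §72.1 / §72.9).  For a rational newform `f ∈ S₂(Γ₀(N))` every cusp `x` whose
denominator is prime to `N` is `Γ₀(N)`-equivalent to `0`, so `y(x) := {∞,x}_f − {∞,0}_f ∈ Λ_f` and `y(x) + \overline{y(x)} = F(x)·Ω⁺_f`
with `F(x) ∈ ℤ`.  Rather than defining `F` (no definitions in a proof file) every statement takes a function `F : ℚ → ℤ` together
with the hypothesis `hF` that it computes these plus parts, and proves: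

* `exists_int_plusPart`, `exists_int_plusPart_cuspSymbol` — existence of the integers (so that `choose` produces `F` and its
  `Γ₀(N)`-companion `Fc` on the periods `{∞, γ∞}_f`);
* `coprime_den_intCast_div_primePow`, `coprime_den_div_of_isCoprime` — denominator bookkeeping;
* `plusFun_intCast` (`F(k) = 0`), `plusFun_add_intCast` (`F(x+k) = F(x)`), `plusFun_neg` (`F(−x) = F(x)`, real coefficients);
* `plusFun_gamma0` — the `Γ₀(N)`-COCYCLE: `F(γx) = Fc(γ) + F(x)` (Manin relation `{∞,γx} = {∞,γ∞} + {∞,x}`);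
* `plusFun_hecke` — the HECKE RELATION at a prime `q ∤ N` for the newform of `W`:
  `Σ_{t<q} F((r + t qᵐ)/q^{m+1}) = a_q(W)·F(r/qᵐ) − F(qr/qᵐ) + Σ_{t<q} F(t/q)` (from `modularSymbol_heckeT_eq_sum` and `T_q f = a_q f`).

HONEST FRAMING: bookkeeping over the tree's modular-symbol API; nothing about Manin's conjecture or BSD is asserted.  No definitions,
no named facts, no sorry.
-/

set_option linter.dupNamespace false
set_option autoImplicit false

noncomputable section

open scoped Classical MatrixGroups ModularForm ComplexConjugate

open CongruenceSubgroup Complex Literature.NumberTheory.EllipticCurves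
  Literature.NumberTheory.EllipticCurves.ModularForms

namespace Summit.BirchSwinnertonDyer.BirchSwinnertonDyer.Theorems.ManinLocalTwoThree

variable {N : ℕ} [NeZero N] {f : CuspForm (Gamma0 N) 2}

/-! ### §1 Existence of the integer plus parts -/

/-- For a rational newform and a cusp `x` of denominator prime to `N`: `({∞,x} − {∞,0}) + conj = k·Ω⁺_f` for some `k ∈ ℤ`
(the statement is packaged as `∃ k, coprime → …` so that `choose` yields a total function). -/
theorem exists_int_plusPart (hf : IsNewform0 f) (hQ : coeffField f = ⊥) (x : ℚ) :
    ∃ k : ℤ, Nat.Coprime x.den N →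
      (modularSymbol f x - modularSymbol f 0) + conj (modularSymbol f x - modularSymbol f 0) =
        (k : ℂ) * (plusPeriod f : ℂ) := by
  by_cases hx : Nat.Coprime x.den N
  · have hNm : IsCoprime (N : ℤ) (x.den : ℤ) := Nat.isCoprime_iff_coprime.mpr (Nat.coprime_comm.mp hx)
    have hmem := modularSymbol_intCast_div_sub_zero_mem_periodLattice f hNm x.num (m := (x.den : ℤ)) dvd_rfl
    have e : ((x.num : ℤ) : ℚ) / ((x.den : ℤ) : ℚ) = x := by push_cast; exact Rat.num_div_den x
    rw [e] at hmem
    obtain ⟨k, hk⟩ := exists_int_add_conj_eq_mul_plusPeriod hf hQ hmem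
    exact ⟨k, fun _ ↦ hk⟩
  · exact ⟨0, fun h ↦ (hx h).elim⟩

/-- For a rational newform and `γ ∈ Γ₀(N)`: `{∞,γ∞} + conj = k·Ω⁺_f` for some `k ∈ ℤ` (packaged over all of `SL(2,ℤ)`). -/
theorem exists_int_plusPart_cuspSymbol (hf : IsNewform0 f) (hQ : coeffField f = ⊥) (γ : SL(2, ℤ)) :
    ∃ k : ℤ, ∀ hγ : γ ∈ Gamma0 N,
      cuspSymbol f ⟨γ, hγ⟩ + conj (cuspSymbol f ⟨γ, hγ⟩) = (k : ℂ) * (plusPeriod f : ℂ) := by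
  by_cases hγ : γ ∈ Gamma0 N
  · obtain ⟨k, hk⟩ := exists_int_add_conj_eq_mul_plusPeriod hf hQ (cuspSymbol_mem_periodLattice f ⟨γ, hγ⟩)
    exact ⟨k, fun _ ↦ hk⟩
  · exact ⟨0, fun h ↦ (hγ h).elim⟩

/-! ### §2 Denominators -/

omit [NeZero N] in
/-- The denominator of `r / qⁿ` is prime to `N` when `q ∤ N` is prime. -/
theorem coprime_den_intCast_div_primePow {q : ℕ} (hq : q.Prime) (hqN : ¬ q ∣ N) (r : ℤ) (n : ℕ) :
    Nat.Coprime ((r : ℚ) / (q : ℚ) ^ n).den N := by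
  obtain ⟨i, hi⟩ := exists_den_qadic_eq_pow hq r n
  rw [hi]
  exact Nat.Coprime.pow_left i ((Nat.Prime.coprime_iff_not_dvd hq).mpr hqN)

omit [NeZero N] in
/-- The denominator of `B / D` is prime to `N` when `D` is. -/
theorem coprime_den_div_of_isCoprime (B : ℤ) {D : ℤ} (hDN : IsCoprime D (N : ℤ)) :
    Nat.Coprime ((B : ℚ) / (D : ℚ)).den N := by
  have h := Rat.den_dvd B D
  rw [Rat.divInt_eq_div] at h
  exact Nat.isCoprime_iff_coprime.mp (hDN.of_isCoprime_of_dvd_left h)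

/-! ### §3 Formal properties of the plus functional -/

section PlusFun

variable (hf : IsNewform0 f) (hQ : coeffField f = ⊥) (F : ℚ → ℤ)
  (hF : ∀ x : ℚ, Nat.Coprime x.den N →
    (modularSymbol f x - modularSymbol f 0) + conj (modularSymbol f x - modularSymbol f 0) =
      (F x : ℂ) * (plusPeriod f : ℂ))
include hf hQ hF

/-- `F(k) = 0` for integers `k` (`{∞,k} = {∞,0}`). -/
theorem plusFun_intCast (r : ℤ) : F (r : ℚ) = 0 := by
  obtain ⟨hpos, -⟩ := plusPeriod_pos_and_realPeriods_eq isZLattice_periodLattice_holds hf hQ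
  have hΩ : (plusPeriod f : ℂ) ≠ 0 := by exact_mod_cast hpos.ne'
  have h := hF (r : ℚ) (by rw [Rat.den_intCast]; exact Nat.coprime_one_left N)
  have e : modularSymbol f (r : ℚ) = modularSymbol f 0 := by
    have := modularSymbol_add_intCast_holds f 0 r
    rwa [zero_add] at this
  rw [e, sub_self, map_zero, add_zero] at h
  have : ((F (r : ℚ) : ℤ) : ℂ) = 0 := by
    rcases mul_eq_zero.mp h.symm with h1 | h1
    · exact h1
    · exact absurd h1 hΩ
  exact_mod_cast this

/-- `F(x + k) = F(x)` (translation invariance of `{∞,·}`). -/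
theorem plusFun_add_intCast (x : ℚ) (hx : Nat.Coprime x.den N) (k : ℤ) : F (x + k) = F x := by
  obtain ⟨hpos, -⟩ := plusPeriod_pos_and_realPeriods_eq isZLattice_periodLattice_holds hf hQ
  have hΩ : (plusPeriod f : ℂ) ≠ 0 := by exact_mod_cast hpos.ne'
  have h1 := hF (x + k) (by rw [Rat.add_intCast_den]; exact hx)
  have h2 := hF x hx
  rw [modularSymbol_add_intCast_holds f x k, h2] at h1
  exact_mod_cast (mul_right_cancel₀ hΩ h1).symm

/-- `F(−x) = F(x)` (`{∞,−x} = conj {∞,x}` for real coefficients; the plus part is conjugation-invariant). -/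
theorem plusFun_neg (x : ℚ) (hx : Nat.Coprime x.den N) : F (-x) = F x := by
  obtain ⟨hpos, -⟩ := plusPeriod_pos_and_realPeriods_eq isZLattice_periodLattice_holds hf hQ
  have hΩ : (plusPeriod f : ℂ) ≠ 0 := by exact_mod_cast hpos.ne'
  have hreal : ∀ n, (cuspCoeff f n).im = 0 := cuspCoeff_im_eq_zero_of_coeffField_eq_bot hQ
  have h0 : conj (modularSymbol f 0) = modularSymbol f 0 := by
    have := modularSymbol_neg_eq_conj_holds f hreal 0
    rw [neg_zero] at this
    exact this.symm
  have h1 := hF (-x) (by rw [Rat.den_neg_eq_den]; exact hx)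
  have h2 := hF x hx
  rw [modularSymbol_neg_eq_conj_holds f hreal x] at h1
  have e : conj (modularSymbol f x) - modularSymbol f 0 + conj (conj (modularSymbol f x) - modularSymbol f 0) =
      (modularSymbol f x - modularSymbol f 0) + conj (modularSymbol f x - modularSymbol f 0) := by
    rw [map_sub, map_sub, Complex.conj_conj, h0]; ring
  rw [e, h2] at h1
  exact_mod_cast (mul_right_cancel₀ hΩ h1).symm

/-- **The `Γ₀(N)`-cocycle**: for `γ ∈ Γ₀(N)` and a cusp `B/D` with `D` prime to `N` and `γ(B/D) ≠ ∞`,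
`F(γ(B/D)) = Fc(γ) + F(B/D)` where `Fc(γ)·Ω⁺ = {∞,γ∞} + conj` (Manin relation `{∞, γx} = {∞, γ∞} + {∞, x}`). -/
theorem plusFun_gamma0 (Fc : SL(2, ℤ) → ℤ)
    (hFc : ∀ (γ : SL(2, ℤ)) (hγ : γ ∈ Gamma0 N),
      cuspSymbol f ⟨γ, hγ⟩ + conj (cuspSymbol f ⟨γ, hγ⟩) = (Fc γ : ℂ) * (plusPeriod f : ℂ))
    (γ : SL(2, ℤ)) (hγ : γ ∈ Gamma0 N) (B D : ℤ) (hD : D ≠ 0) (hDN : IsCoprime D (N : ℤ))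
    (hden : γ 1 0 * B + γ 1 1 * D ≠ 0) :
    F (((γ 0 0 * B + γ 0 1 * D : ℤ) : ℚ) / ((γ 1 0 * B + γ 1 1 * D : ℤ) : ℚ)) = Fc γ + F ((B : ℚ) / (D : ℚ)) := by
  obtain ⟨hpos, -⟩ := plusPeriod_pos_and_realPeriods_eq isZLattice_periodLattice_holds hf hQ
  have hΩ : (plusPeriod f : ℂ) ≠ 0 := by exact_mod_cast hpos.ne'
  have hDq : (D : ℚ) ≠ 0 := by exact_mod_cast hD
  have hQq : ((γ 1 0 * B + γ 1 1 * D : ℤ) : ℚ) ≠ 0 := by exact_mod_cast hden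
  -- the Manin relation at `r = B/D`
  have hr : (((⟨γ, hγ⟩ : Gamma0 N) : SL(2, ℤ)) 1 0 : ℚ) * ((B : ℚ) / D) + (((⟨γ, hγ⟩ : Gamma0 N) : SL(2, ℤ)) 1 1 : ℚ) ≠ 0 := by
    intro h0
    apply hQq
    have : ((γ 1 0 : ℤ) : ℚ) * ((B : ℚ) / D) + ((γ 1 1 : ℤ) : ℚ) = ((γ 1 0 * B + γ 1 1 * D : ℤ) : ℚ) / D := by
      push_cast; field_simp
    have h0' : ((γ 1 0 : ℤ) : ℚ) * ((B : ℚ) / D) + ((γ 1 1 : ℤ) : ℚ) = 0 := h0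
    rw [this, div_eq_zero_iff] at h0'
    exact h0'.resolve_right hDq
  have key := modularSymbol_gamma0_smul_holds f ⟨γ, hγ⟩ ((B : ℚ) / D) hr
  have e : ((((⟨γ, hγ⟩ : Gamma0 N) : SL(2, ℤ)) 0 0 : ℚ) * ((B : ℚ) / D) + (((⟨γ, hγ⟩ : Gamma0 N) : SL(2, ℤ)) 0 1 : ℚ)) /
      ((((⟨γ, hγ⟩ : Gamma0 N) : SL(2, ℤ)) 1 0 : ℚ) * ((B : ℚ) / D) + (((⟨γ, hγ⟩ : Gamma0 N) : SL(2, ℤ)) 1 1 : ℚ)) =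
      ((γ 0 0 * B + γ 0 1 * D : ℤ) : ℚ) / ((γ 1 0 * B + γ 1 1 * D : ℤ) : ℚ) := by
    rw [div_eq_div_iff ?_ hQq]
    · push_cast; field_simp
    · exact hr
  rw [e] at key
  -- denominators prime to `N`
  have hγN : (N : ℤ) ∣ γ 1 0 := by
    have := Gamma0_mem.mp hγ
    exact (ZMod.intCast_zmod_eq_zero_iff_dvd _ N).mp this
  obtain ⟨k, hk⟩ := hγN
  have hdet : γ 0 0 * γ 1 1 - γ 0 1 * γ 1 0 = 1 := by
    have := Matrix.det_fin_two (γ : Matrix (Fin 2) (Fin 2) ℤ)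
    rw [γ.2] at this
    linarith
  have h11 : IsCoprime (γ 1 1) (N : ℤ) := ⟨γ 0 0, -(γ 0 1 * k), by rw [hk] at hdet; linear_combination hdet⟩
  have hQN : IsCoprime (γ 1 0 * B + γ 1 1 * D) (N : ℤ) := by
    have h2 : IsCoprime (γ 1 1 * D) (N : ℤ) := h11.mul_left hDN
    have h3 := h2.add_mul_left_left (k * B)
    have e2 : γ 1 1 * D + (N : ℤ) * (k * B) = γ 1 0 * B + γ 1 1 * D := by rw [hk]; ring
    rwa [e2] at h3
  have h1 := hF _ (coprime_den_div_of_isCoprime (γ 0 0 * B + γ 0 1 * D) hQN)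
  have h2 := hF _ (coprime_den_div_of_isCoprime B hDN)
  have h3 := hFc γ hγ
  have e3 : (modularSymbol f (((γ 0 0 * B + γ 0 1 * D : ℤ) : ℚ) / ((γ 1 0 * B + γ 1 1 * D : ℤ) : ℚ)) - modularSymbol f 0) +
      conj (modularSymbol f (((γ 0 0 * B + γ 0 1 * D : ℤ) : ℚ) / ((γ 1 0 * B + γ 1 1 * D : ℤ) : ℚ)) - modularSymbol f 0) =
      (cuspSymbol f ⟨γ, hγ⟩ + conj (cuspSymbol f ⟨γ, hγ⟩)) +
        ((modularSymbol f ((B : ℚ) / D) - modularSymbol f 0) + conj (modularSymbol f ((B : ℚ) / D) - modularSymbol f 0)) := by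
    rw [key, map_sub, map_sub, map_add]; ring
  rw [h1, h2, h3, ← add_mul] at e3
  exact_mod_cast mul_right_cancel₀ hΩ e3

end PlusFun

/-! ### §4 The Hecke relation at a prime `q ∤ N` -/

/-- **Hecke relation for the plus functional** of the newform `f` of `W` at a prime `q ∤ N`:
`Σ_{t<q} F((r + t qᵐ)/q^{m+1}) = a_q(W)·F(r/qᵐ) − F(qr/qᵐ) + Σ_{t<q} F(t/q)` for every `m ≥ 0`, `r ∈ ℤ`
(`T_q{∞,x} = Σ_t {∞,(x+t)/q} + {∞,qx}`, `T_q f = a_q f`, evaluated at `x = r/qᵐ` and at `x = 0`). -/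
theorem plusFun_hecke {W : WeierstrassCurve ℚ} (hWf : IsNewformOf W f) {q : ℕ} (hq : q.Prime) (hqN : ¬ q ∣ N)
    (F : ℚ → ℤ)
    (hF : ∀ x : ℚ, Nat.Coprime x.den N →
      (modularSymbol f x - modularSymbol f 0) + conj (modularSymbol f x - modularSymbol f 0) =
        (F x : ℂ) * (plusPeriod f : ℂ))
    (m : ℕ) (r : ℤ) :
    ∑ t ∈ Finset.range q, F ((((r + (t : ℤ) * (q : ℤ) ^ m : ℤ)) : ℚ) / (q : ℚ) ^ (m + 1)) =
      W.LFunction q * F ((r : ℚ) / (q : ℚ) ^ m) - F ((((q : ℤ) * r : ℤ) : ℚ) / (q : ℚ) ^ m) +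
        ∑ t ∈ Finset.range q, F (((t : ℤ) : ℚ) / (q : ℚ) ^ 1) := by
  haveI : NeZero q := ⟨hq.ne_zero⟩
  have hf : IsNewform0 f := hWf.1
  have hQ : coeffField f = ⊥ := hWf.coeffField_eq_bot
  obtain ⟨hpos, -⟩ := plusPeriod_pos_and_realPeriods_eq isZLattice_periodLattice_holds hf hQ
  have hΩ : (plusPeriod f : ℝ) ≠ 0 := hpos.ne'
  have hq0 : (q : ℚ) ≠ 0 := by exact_mod_cast hq.ne_zero
  -- `T_q f = a_q • f` with `a_q = a_q(W) ∈ ℤ`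
  set a : ℤ := W.LFunction q with ha
  have hT : heckeT (Gamma0 N) 2 q f = (a : ℂ) • f := by
    rw [hf.heckeT_eq_coeff_smul hq]
    have h2 : cuspCoeff f q = (a : ℂ) := hWf.2 q
    exact congrArg (· • f) h2
  have hx : ∀ x : ℚ, (a : ℂ) * modularSymbol f x =
      ∑ j : Fin q, modularSymbol f ((x + ((j : ℕ) : ℤ)) / q) + modularSymbol f (q * x) := by
    intro x
    have h := modularSymbol_heckeT_eq_sum q f hq x
    rw [hT, modularSymbol_const_smul, if_neg hqN] at h
    exact h
  -- real parts: `F x · Ω = 2 re ({∞,x} − {∞,0})`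
  have hre : ∀ x : ℚ, Nat.Coprime x.den N →
      (F x : ℝ) * plusPeriod f = 2 * ((modularSymbol f x).re - (modularSymbol f 0).re) := by
    intro x hx
    have h := hF x hx
    rw [Complex.add_conj] at h
    have h' := congrArg Complex.re h
    simp only [Complex.ofReal_re, Complex.mul_re, Complex.intCast_re, Complex.intCast_im, Complex.ofReal_im,
      mul_zero, sub_zero, Complex.sub_re] at h'
    linarith
  -- the points
  set x₀ : ℚ := (r : ℚ) / (q : ℚ) ^ m with hx₀
  have eA : ∀ t : ℕ, (x₀ + ((t : ℕ) : ℤ)) / q = (((r + (t : ℤ) * (q : ℤ) ^ m : ℤ)) : ℚ) / (q : ℚ) ^ (m + 1) := by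
    intro t; rw [hx₀]; push_cast; field_simp; ring
  have eB : (q : ℚ) * x₀ = (((q : ℤ) * r : ℤ) : ℚ) / (q : ℚ) ^ m := by rw [hx₀]; push_cast; ring
  have eC : ∀ t : ℕ, ((0 : ℚ) + ((t : ℕ) : ℤ)) / q = ((t : ℤ) : ℚ) / (q : ℚ) ^ 1 := by
    intro t; push_cast; ring
  -- the complex identity `a·y(x₀) = Σ_t (y(A_t) − y(C_t)) + y(B)`
  have h1 := hx x₀
  have h0 := hx 0
  simp only [eA, eB] at h1
  simp only [eC, mul_zero] at h0
  have key : (a : ℂ) * (modularSymbol f x₀ - modularSymbol f 0) =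
      ∑ j : Fin q, ((modularSymbol f ((((r + ((j : ℕ) : ℤ) * (q : ℤ) ^ m : ℤ)) : ℚ) / (q : ℚ) ^ (m + 1)) - modularSymbol f 0) -
        (modularSymbol f ((((j : ℕ) : ℤ) : ℚ) / (q : ℚ) ^ 1) - modularSymbol f 0)) +
      (modularSymbol f ((((q : ℤ) * r : ℤ) : ℚ) / (q : ℚ) ^ m) - modularSymbol f 0) := by
    rw [mul_sub, h1, h0]
    simp only [Finset.sum_sub_distrib, Finset.sum_const, Finset.card_univ, Fintype.card_fin, nsmul_eq_mul]
    ring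
  -- take real parts
  have keyre := congrArg Complex.re key
  simp only [Complex.mul_re, Complex.intCast_re, Complex.intCast_im, zero_mul, sub_zero, Complex.add_re,
    Complex.sub_re, Complex.re_sum, Finset.sum_sub_distrib] at keyre
  have hA : ∀ t : ℕ, (F ((((r + (t : ℤ) * (q : ℤ) ^ m : ℤ)) : ℚ) / (q : ℚ) ^ (m + 1)) : ℝ) * plusPeriod f =
      2 * ((modularSymbol f ((((r + (t : ℤ) * (q : ℤ) ^ m : ℤ)) : ℚ) / (q : ℚ) ^ (m + 1))).re - (modularSymbol f 0).re) :=
    fun t ↦ hre _ (coprime_den_intCast_div_primePow hq hqN _ _)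
  have hB : (F ((((q : ℤ) * r : ℤ) : ℚ) / (q : ℚ) ^ m) : ℝ) * plusPeriod f =
      2 * ((modularSymbol f ((((q : ℤ) * r : ℤ) : ℚ) / (q : ℚ) ^ m)).re - (modularSymbol f 0).re) :=
    hre _ (coprime_den_intCast_div_primePow hq hqN _ _)
  have hC : ∀ t : ℕ, (F (((t : ℤ) : ℚ) / (q : ℚ) ^ 1) : ℝ) * plusPeriod f =
      2 * ((modularSymbol f (((t : ℤ) : ℚ) / (q : ℚ) ^ 1)).re - (modularSymbol f 0).re) :=
    fun t ↦ hre _ (coprime_den_intCast_div_primePow hq hqN _ _)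
  have hX : (F x₀ : ℝ) * plusPeriod f = 2 * ((modularSymbol f x₀).re - (modularSymbol f 0).re) :=
    hre _ (coprime_den_intCast_div_primePow hq hqN r m)
  have goalR : ((∑ t ∈ Finset.range q, F ((((r + (t : ℤ) * (q : ℤ) ^ m : ℤ)) : ℚ) / (q : ℚ) ^ (m + 1)) : ℤ) : ℝ) *
        plusPeriod f =
      ((a * F x₀ - F ((((q : ℤ) * r : ℤ) : ℚ) / (q : ℚ) ^ m) + ∑ t ∈ Finset.range q, F (((t : ℤ) : ℚ) / (q : ℚ) ^ 1) : ℤ) : ℝ) *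
        plusPeriod f := by
    rw [Int.cast_add, Int.cast_sub, Int.cast_mul a, Int.cast_sum, Int.cast_sum, add_mul, sub_mul, Finset.sum_mul,
      Finset.sum_mul, mul_assoc, hX, hB]
    simp_rw [hA, hC]
    rw [← Finset.mul_sum, ← Finset.mul_sum,
      Finset.sum_range (fun t ↦ (modularSymbol f ((((r + (t : ℤ) * (q : ℤ) ^ m : ℤ)) : ℚ) / (q : ℚ) ^ (m + 1))).re -
        (modularSymbol f 0).re),
      Finset.sum_range (fun t ↦ (modularSymbol f (((t : ℤ) : ℚ) / (q : ℚ) ^ 1)).re - (modularSymbol f 0).re)]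
    simp only [Finset.sum_sub_distrib]
    linear_combination (-2 : ℝ) * keyre
  exact_mod_cast mul_right_cancel₀ hΩ goalR

end Summit.BirchSwinnertonDyer.BirchSwinnertonDyer.Theorems.ManinLocalTwoThree

end
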